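import Literature.Probability.Percolation.PartitionLatticeSplitComponents
import Literature.Probability.Percolation.LonePortSum
import Summits.CriticalPhenomena.PercolationContinuityZ3.Theorems.PercNearOneGluingNoHeavyLowerTailSuperTerminalQuarticFace
import HarnessLib

/-!
# The row events `F`, `I`, `IA`, `IB` in down-set coordinates of `{s,a,b,c}`, and the terminal piece pair by pair

Support file for crux `stmt-CriticalPhenomena-4575` (`NoHeavyLowerTail`), seat `prim-l12-p1` gen 32 (`--supports stmt-CriticalPhenomena-4575`);
graph-level assembly of the `∥`-stability theorems (lead gen 134 spec `GRAPH-LEVEL-SPEC-g134.md`), part 2 of 3 (part 1: `…SuperTerminalDownsets`,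
part 3: `…SuperTerminalP3HalfGluing`).  Logically independent of part 1.  No definitions, no sorries, standard axioms.

With the eight principal down-sets of `T₄ = {s,a,b,c}` written as explicit intersections of non-connection events (`d0 = D(s|a|b|c)`,
`d1 = D(sa|b|c)`, `d2 = D(sa|bc)`, `d3 = D(s|a|bc)`, `d4 = D(sac|b)`, `d5 = D(sc|a|b)`, `d6 = D(ac|s|b)`, `d7 = D(c|sab)`; dictionary in part 1)
and the row events of `SuperTerminalQuarticFace` (`F = {s↔a}∩{s↮b}`, `I = c ∤ {s,a,b}`, `IA = c ∤ {s,a}`, `IB = {c↮b}`):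

* `F_inter_I_eq`, `F_inter_IA_eq`, `F_inter_IB_eq`, `blk5_inter_blk6_eq` — the set identities `F∩I = d1∖d0`, `F∩IA = d2∖d3`,
  `F∩IB = d4∖(d5∪d6)`, `d5∩d6 = d0` (inclusion–exclusion on the partition lattice; spec §2);
* `real_F_inter_I`, `real_F_inter_IA`, `real_F_inter_IB`, `real_F`, `real_F_inter_conn`, `real_conn`, `order_relations` — for every weight:
  `μ(F∩I) = d1 − d0`, `μ(F∩IA) = d2 − d3`, `μ(F∩IB) = d4 − d5 − d6 + d0`, `μ(F) = (d2−d3)+(d4−d5−d6+d0)−(d1−d0)`, `μ(F ∩ c↔T)`,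
  `μ(c↔T) = 1 − d7`, and `d0 ≤ d1, d3, d5, d6`, `d7 ≤ 1`, `ζ ≥ 0`, `τ+… ≥ 0` (the hypotheses of the cell-level `dvec` theorems);
* `real_partLE_terminal_mul`, `real_partLE_zero`, `real_openConn_eq_zero_of_single` — the terminal piece `G⁰ = (T₄, terminal pairs)` pair by
  pair: down-set probabilities of terminal-only weights multiply over disjoint supports [BeicheltTittmann2012, Thm. 7.5 (cross factor)];
  the empty graph has all down-sets sure; a one-pair weight joins nothing but its own pair.
-/

namespace Summit.CriticalPhenomena.PercolationContinuityZ3.Theorems.SuperTerminalDownsetEvents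

open MeasureTheory Set
open Literature.Probability.Percolation Literature.Probability.Percolation.PartitionGluing
open Literature.Probability.LatticeModels (prodBernoulli)
open scoped Classical

variable {V : Type*} [Fintype V]

/-! ## The events of the rows in down-set coordinates (pure set algebra + additivity) -/

section Events
variable (u : Sym2 V → unitInterval) (s a b c : V)

omit [Fintype V] in
/-- `(E0)`: `F ∩ I = D(sa|b|c) ∖ D(s|a|b|c)` as events (`F = {s↔a}∩{s↮b}`, `I = c ∤ {s,a,b}`). [this work] -/
theorem F_inter_I_eq :
    (openConn s a ∩ (openConn s b)ᶜ ∩ ((openConn c s)ᶜ ∩ (openConn c a)ᶜ ∩ (openConn c b)ᶜ) : Set (BondConfig V)) =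
      ((openConn s b)ᶜ ∩ (openConn s c)ᶜ ∩ (openConn a b)ᶜ ∩ (openConn a c)ᶜ ∩ (openConn b c)ᶜ) \
        ((openConn s a)ᶜ ∩ (openConn s b)ᶜ ∩ (openConn s c)ᶜ ∩ (openConn a b)ᶜ ∩ (openConn a c)ᶜ ∩ (openConn b c)ᶜ) := by
  ext ω
  simp only [mem_inter_iff, mem_sdiff, mem_compl_iff]
  constructor
  · rintro ⟨⟨hsa, hsb⟩, ⟨hcs, hca⟩, hcb⟩
    exact ⟨⟨⟨⟨⟨hsb, fun h => hcs (LonePortSum.mem_openConn_symm h)⟩, fun h => hsb (LonePortSum.mem_openConn_trans hsa h)⟩,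
      fun h => hca (LonePortSum.mem_openConn_symm h)⟩, fun h => hcb (LonePortSum.mem_openConn_symm h)⟩,
      fun h => h.1.1.1.1.1 hsa⟩
  · rintro ⟨⟨⟨⟨⟨hsb, hsc⟩, hab⟩, hac⟩, hbc⟩, h0⟩
    have hsa : ω ∈ openConn s a := by
      by_contra h
      exact h0 ⟨⟨⟨⟨⟨h, hsb⟩, hsc⟩, hab⟩, hac⟩, hbc⟩
    exact ⟨⟨hsa, hsb⟩, ⟨fun h => hsc (LonePortSum.mem_openConn_symm h), fun h => hac (LonePortSum.mem_openConn_symm h)⟩,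
      fun h => hbc (LonePortSum.mem_openConn_symm h)⟩

omit [Fintype V] in
/-- `(E1)`: `F ∩ IA = D(sa|bc) ∖ D(s|a|bc)` (`IA = c ∤ {s,a}`). [this work] -/
theorem F_inter_IA_eq :
    (openConn s a ∩ (openConn s b)ᶜ ∩ ((openConn c s)ᶜ ∩ (openConn c a)ᶜ) : Set (BondConfig V)) =
      ((openConn s b)ᶜ ∩ (openConn s c)ᶜ ∩ (openConn a b)ᶜ ∩ (openConn a c)ᶜ) \
        ((openConn s a)ᶜ ∩ (openConn s b)ᶜ ∩ (openConn s c)ᶜ ∩ (openConn a b)ᶜ ∩ (openConn a c)ᶜ) := by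
  ext ω
  simp only [mem_inter_iff, mem_sdiff, mem_compl_iff]
  constructor
  · rintro ⟨⟨hsa, hsb⟩, hcs, hca⟩
    exact ⟨⟨⟨⟨hsb, fun h => hcs (LonePortSum.mem_openConn_symm h)⟩, fun h => hsb (LonePortSum.mem_openConn_trans hsa h)⟩,
      fun h => hca (LonePortSum.mem_openConn_symm h)⟩, fun h => h.1.1.1.1 hsa⟩
  · rintro ⟨⟨⟨⟨hsb, hsc⟩, hab⟩, hac⟩, h0⟩
    have hsa : ω ∈ openConn s a := by
      by_contra h
      exact h0 ⟨⟨⟨⟨h, hsb⟩, hsc⟩, hab⟩, hac⟩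
    exact ⟨⟨hsa, hsb⟩, fun h => hsc (LonePortSum.mem_openConn_symm h), fun h => hac (LonePortSum.mem_openConn_symm h)⟩

omit [Fintype V] in
/-- `(E2)`: `F ∩ IB = D(sac|b) ∖ (D(sc|a|b) ∪ D(ac|s|b))` (`IB = {c↮b}`): on `D(sac|b)`, `s ↔ a` fails iff `a` or `s` is a singleton. [this work] -/
theorem F_inter_IB_eq :
    (openConn s a ∩ (openConn s b)ᶜ ∩ (openConn c b)ᶜ : Set (BondConfig V)) =
      ((openConn s b)ᶜ ∩ (openConn a b)ᶜ ∩ (openConn b c)ᶜ) \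
        (((openConn s a)ᶜ ∩ (openConn s b)ᶜ ∩ (openConn a b)ᶜ ∩ (openConn a c)ᶜ ∩ (openConn b c)ᶜ) ∪
          ((openConn s a)ᶜ ∩ (openConn s b)ᶜ ∩ (openConn s c)ᶜ ∩ (openConn a b)ᶜ ∩ (openConn b c)ᶜ)) := by
  ext ω
  simp only [mem_inter_iff, mem_sdiff, mem_union, mem_compl_iff]
  constructor
  · rintro ⟨⟨hsa, hsb⟩, hcb⟩
    refine ⟨⟨⟨hsb, fun h => hsb (LonePortSum.mem_openConn_trans hsa h)⟩, fun h => hcb (LonePortSum.mem_openConn_symm h)⟩, ?_⟩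
    rintro (h | h)
    · exact h.1.1.1.1 hsa
    · exact h.1.1.1.1 hsa
  · rintro ⟨⟨⟨hsb, hab⟩, hbc⟩, h0⟩
    have hsa : ω ∈ openConn s a := by
      by_contra h
      refine h0 ?_
      by_cases hac : ω ∈ openConn a c
      · refine Or.inr ⟨⟨⟨⟨h, hsb⟩, fun hsc => h (LonePortSum.mem_openConn_trans hsc (LonePortSum.mem_openConn_symm hac))⟩, hab⟩, hbc⟩
      · exact Or.inl ⟨⟨⟨⟨h, hsb⟩, hab⟩, hac⟩, hbc⟩
    exact ⟨⟨hsa, hsb⟩, fun h => hbc (LonePortSum.mem_openConn_symm h)⟩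

omit [Fintype V] in
/-- `D(sc|a|b) ∩ D(ac|s|b) = D(s|a|b|c)`. [this work] -/
theorem blk5_inter_blk6_eq :
    (((openConn s a)ᶜ ∩ (openConn s b)ᶜ ∩ (openConn a b)ᶜ ∩ (openConn a c)ᶜ ∩ (openConn b c)ᶜ) ∩
        ((openConn s a)ᶜ ∩ (openConn s b)ᶜ ∩ (openConn s c)ᶜ ∩ (openConn a b)ᶜ ∩ (openConn b c)ᶜ) : Set (BondConfig V)) =
      (openConn s a)ᶜ ∩ (openConn s b)ᶜ ∩ (openConn s c)ᶜ ∩ (openConn a b)ᶜ ∩ (openConn a c)ᶜ ∩ (openConn b c)ᶜ := by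
  ext ω
  simp only [mem_inter_iff, mem_compl_iff]
  tauto

/-- `μ(F ∩ I) = D(sa|b|c) − D(s|a|b|c)`. [this work] -/
theorem real_F_inter_I :
    (prodBernoulli u).real (openConn s a ∩ (openConn s b)ᶜ ∩ ((openConn c s)ᶜ ∩ (openConn c a)ᶜ ∩ (openConn c b)ᶜ)) =
      (prodBernoulli u).real ((openConn s b)ᶜ ∩ (openConn s c)ᶜ ∩ (openConn a b)ᶜ ∩ (openConn a c)ᶜ ∩ (openConn b c)ᶜ) -
        (prodBernoulli u).real ((openConn s a)ᶜ ∩ (openConn s b)ᶜ ∩ (openConn s c)ᶜ ∩ (openConn a b)ᶜ ∩ (openConn a c)ᶜ ∩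
          (openConn b c)ᶜ) := by
  rw [F_inter_I_eq]
  refine measureReal_sdiff ?_ MeasurableSet.of_discrete
  rintro ω ⟨⟨⟨⟨⟨-, h2⟩, h3⟩, h4⟩, h5⟩, h6⟩
  exact ⟨⟨⟨⟨h2, h3⟩, h4⟩, h5⟩, h6⟩

/-- `μ(F ∩ IA) = D(sa|bc) − D(s|a|bc)`. [this work] -/
theorem real_F_inter_IA :
    (prodBernoulli u).real (openConn s a ∩ (openConn s b)ᶜ ∩ ((openConn c s)ᶜ ∩ (openConn c a)ᶜ)) =
      (prodBernoulli u).real ((openConn s b)ᶜ ∩ (openConn s c)ᶜ ∩ (openConn a b)ᶜ ∩ (openConn a c)ᶜ) -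
        (prodBernoulli u).real ((openConn s a)ᶜ ∩ (openConn s b)ᶜ ∩ (openConn s c)ᶜ ∩ (openConn a b)ᶜ ∩ (openConn a c)ᶜ) := by
  rw [F_inter_IA_eq]
  refine measureReal_sdiff ?_ MeasurableSet.of_discrete
  rintro ω ⟨⟨⟨⟨-, h2⟩, h3⟩, h4⟩, h5⟩
  exact ⟨⟨⟨h2, h3⟩, h4⟩, h5⟩

/-- `μ(F ∩ IB) = D(sac|b) − D(sc|a|b) − D(ac|s|b) + D(s|a|b|c)`. [this work] -/
theorem real_F_inter_IB :
    (prodBernoulli u).real (openConn s a ∩ (openConn s b)ᶜ ∩ (openConn c b)ᶜ) =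
      (prodBernoulli u).real ((openConn s b)ᶜ ∩ (openConn a b)ᶜ ∩ (openConn b c)ᶜ) -
        (prodBernoulli u).real ((openConn s a)ᶜ ∩ (openConn s b)ᶜ ∩ (openConn a b)ᶜ ∩ (openConn a c)ᶜ ∩ (openConn b c)ᶜ) -
        (prodBernoulli u).real ((openConn s a)ᶜ ∩ (openConn s b)ᶜ ∩ (openConn s c)ᶜ ∩ (openConn a b)ᶜ ∩ (openConn b c)ᶜ) +
        (prodBernoulli u).real ((openConn s a)ᶜ ∩ (openConn s b)ᶜ ∩ (openConn s c)ᶜ ∩ (openConn a b)ᶜ ∩ (openConn a c)ᶜ ∩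
          (openConn b c)ᶜ) := by
  rw [F_inter_IB_eq, measureReal_sdiff ?_ MeasurableSet.of_discrete, ← blk5_inter_blk6_eq s a b c]
  · have h := measureReal_union_add_inter (μ := prodBernoulli u)
      (s := ((openConn s a)ᶜ ∩ (openConn s b)ᶜ ∩ (openConn a b)ᶜ ∩ (openConn a c)ᶜ ∩ (openConn b c)ᶜ : Set (BondConfig V)))
      (t := ((openConn s a)ᶜ ∩ (openConn s b)ᶜ ∩ (openConn s c)ᶜ ∩ (openConn a b)ᶜ ∩ (openConn b c)ᶜ : Set (BondConfig V)))
      MeasurableSet.of_discrete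
    linarith
  · rintro ω (⟨⟨⟨⟨-, h2⟩, h3⟩, -⟩, h5⟩ | ⟨⟨⟨⟨-, h2⟩, -⟩, h4⟩, h5⟩)
    · exact ⟨⟨h2, h3⟩, h5⟩
    · exact ⟨⟨h2, h4⟩, h5⟩

/-- `μ(F) = (d2 − d3) + (d4 − d5 − d6 + d0) − (d1 − d0)` in down-set coordinates (via `SuperTerminalQuarticFace.real_F_add`). [this work] -/
theorem real_F :
    (prodBernoulli u).real (openConn s a ∩ (openConn s b)ᶜ : Set (BondConfig V)) =
      ((prodBernoulli u).real ((openConn s b)ᶜ ∩ (openConn s c)ᶜ ∩ (openConn a b)ᶜ ∩ (openConn a c)ᶜ) -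
        (prodBernoulli u).real ((openConn s a)ᶜ ∩ (openConn s b)ᶜ ∩ (openConn s c)ᶜ ∩ (openConn a b)ᶜ ∩ (openConn a c)ᶜ)) +
      ((prodBernoulli u).real ((openConn s b)ᶜ ∩ (openConn a b)ᶜ ∩ (openConn b c)ᶜ) -
        (prodBernoulli u).real ((openConn s a)ᶜ ∩ (openConn s b)ᶜ ∩ (openConn a b)ᶜ ∩ (openConn a c)ᶜ ∩ (openConn b c)ᶜ) -
        (prodBernoulli u).real ((openConn s a)ᶜ ∩ (openConn s b)ᶜ ∩ (openConn s c)ᶜ ∩ (openConn a b)ᶜ ∩ (openConn b c)ᶜ) +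
        (prodBernoulli u).real ((openConn s a)ᶜ ∩ (openConn s b)ᶜ ∩ (openConn s c)ᶜ ∩ (openConn a b)ᶜ ∩ (openConn a c)ᶜ ∩
          (openConn b c)ᶜ)) -
      ((prodBernoulli u).real ((openConn s b)ᶜ ∩ (openConn s c)ᶜ ∩ (openConn a b)ᶜ ∩ (openConn a c)ᶜ ∩ (openConn b c)ᶜ) -
        (prodBernoulli u).real ((openConn s a)ᶜ ∩ (openConn s b)ᶜ ∩ (openConn s c)ᶜ ∩ (openConn a b)ᶜ ∩ (openConn a c)ᶜ ∩
          (openConn b c)ᶜ)) := by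
  have h := SuperTerminalQuarticFace.real_F_add u s a b c
  rw [real_F_inter_I, real_F_inter_IA, real_F_inter_IB] at h
  linarith

/-- `μ(F ∩ c↔T) = μ(F) − μ(F ∩ I)` in down-set coordinates. [this work] -/
theorem real_F_inter_conn :
    (prodBernoulli u).real (openConn s a ∩ (openConn s b)ᶜ ∩ ((openConn c s)ᶜ ∩ (openConn c a)ᶜ ∩ (openConn c b)ᶜ)ᶜ : Set (BondConfig V)) =
      ((prodBernoulli u).real ((openConn s b)ᶜ ∩ (openConn s c)ᶜ ∩ (openConn a b)ᶜ ∩ (openConn a c)ᶜ) -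
        (prodBernoulli u).real ((openConn s a)ᶜ ∩ (openConn s b)ᶜ ∩ (openConn s c)ᶜ ∩ (openConn a b)ᶜ ∩ (openConn a c)ᶜ)) +
      ((prodBernoulli u).real ((openConn s b)ᶜ ∩ (openConn a b)ᶜ ∩ (openConn b c)ᶜ) -
        (prodBernoulli u).real ((openConn s a)ᶜ ∩ (openConn s b)ᶜ ∩ (openConn a b)ᶜ ∩ (openConn a c)ᶜ ∩ (openConn b c)ᶜ) -
        (prodBernoulli u).real ((openConn s a)ᶜ ∩ (openConn s b)ᶜ ∩ (openConn s c)ᶜ ∩ (openConn a b)ᶜ ∩ (openConn b c)ᶜ) +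
        (prodBernoulli u).real ((openConn s a)ᶜ ∩ (openConn s b)ᶜ ∩ (openConn s c)ᶜ ∩ (openConn a b)ᶜ ∩ (openConn a c)ᶜ ∩
          (openConn b c)ᶜ)) -
      2 * ((prodBernoulli u).real ((openConn s b)ᶜ ∩ (openConn s c)ᶜ ∩ (openConn a b)ᶜ ∩ (openConn a c)ᶜ ∩ (openConn b c)ᶜ) -
        (prodBernoulli u).real ((openConn s a)ᶜ ∩ (openConn s b)ᶜ ∩ (openConn s c)ᶜ ∩ (openConn a b)ᶜ ∩ (openConn a c)ᶜ ∩
          (openConn b c)ᶜ)) := by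
  rw [SuperTerminalQuarticFace.real_F_inter_compl_cIso, real_F, real_F_inter_I]
  ring

/-- `μ(c ↔ T) = 1 − D(c|sab)`. [this work] -/
theorem real_conn :
    (prodBernoulli u).real ((openConn c s)ᶜ ∩ (openConn c a)ᶜ ∩ (openConn c b)ᶜ : Set (BondConfig V))ᶜ =
      1 - (prodBernoulli u).real ((openConn c s)ᶜ ∩ (openConn c a)ᶜ ∩ (openConn c b)ᶜ : Set (BondConfig V)) := by
  rw [measureReal_compl MeasurableSet.of_discrete, probReal_univ]

/-- The order relations of a down-set vector: `d0 ≤ d1`, `d0 ≤ d3`, `d0 ≤ d5`, `d0 ≤ d6`, `d7 ≤ 1`, `ζ = d2 − d3 − d1 + d0 ≥ 0`,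
`τ-cell sum = d4 − d5 − d6 + d0 − d1 + d0 ≥ 0` (monotonicity of `μ`; `ζ = μ(F∩IA) − μ(F∩I)`, `… = μ(F∩IB) − μ(F∩I)`). [this work] -/
theorem order_relations :
    (prodBernoulli u).real ((openConn s a)ᶜ ∩ (openConn s b)ᶜ ∩ (openConn s c)ᶜ ∩ (openConn a b)ᶜ ∩ (openConn a c)ᶜ ∩ (openConn b c)ᶜ) ≤
        (prodBernoulli u).real ((openConn s b)ᶜ ∩ (openConn s c)ᶜ ∩ (openConn a b)ᶜ ∩ (openConn a c)ᶜ ∩ (openConn b c)ᶜ) ∧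
      (prodBernoulli u).real ((openConn s a)ᶜ ∩ (openConn s b)ᶜ ∩ (openConn s c)ᶜ ∩ (openConn a b)ᶜ ∩ (openConn a c)ᶜ ∩ (openConn b c)ᶜ) ≤
        (prodBernoulli u).real ((openConn s a)ᶜ ∩ (openConn s b)ᶜ ∩ (openConn s c)ᶜ ∩ (openConn a b)ᶜ ∩ (openConn a c)ᶜ) ∧
      (prodBernoulli u).real ((openConn s a)ᶜ ∩ (openConn s b)ᶜ ∩ (openConn s c)ᶜ ∩ (openConn a b)ᶜ ∩ (openConn a c)ᶜ ∩ (openConn b c)ᶜ) ≤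
        (prodBernoulli u).real ((openConn s a)ᶜ ∩ (openConn s b)ᶜ ∩ (openConn a b)ᶜ ∩ (openConn a c)ᶜ ∩ (openConn b c)ᶜ) ∧
      (prodBernoulli u).real ((openConn s a)ᶜ ∩ (openConn s b)ᶜ ∩ (openConn s c)ᶜ ∩ (openConn a b)ᶜ ∩ (openConn a c)ᶜ ∩ (openConn b c)ᶜ) ≤
        (prodBernoulli u).real ((openConn s a)ᶜ ∩ (openConn s b)ᶜ ∩ (openConn s c)ᶜ ∩ (openConn a b)ᶜ ∩ (openConn b c)ᶜ) ∧
      (prodBernoulli u).real ((openConn c s)ᶜ ∩ (openConn c a)ᶜ ∩ (openConn c b)ᶜ : Set (BondConfig V)) ≤ 1 ∧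
      0 ≤ (prodBernoulli u).real ((openConn s b)ᶜ ∩ (openConn s c)ᶜ ∩ (openConn a b)ᶜ ∩ (openConn a c)ᶜ) -
        (prodBernoulli u).real ((openConn s a)ᶜ ∩ (openConn s b)ᶜ ∩ (openConn s c)ᶜ ∩ (openConn a b)ᶜ ∩ (openConn a c)ᶜ) -
        (prodBernoulli u).real ((openConn s b)ᶜ ∩ (openConn s c)ᶜ ∩ (openConn a b)ᶜ ∩ (openConn a c)ᶜ ∩ (openConn b c)ᶜ) +
        (prodBernoulli u).real ((openConn s a)ᶜ ∩ (openConn s b)ᶜ ∩ (openConn s c)ᶜ ∩ (openConn a b)ᶜ ∩ (openConn a c)ᶜ ∩ (openConn b c)ᶜ) ∧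
      0 ≤ (prodBernoulli u).real ((openConn s b)ᶜ ∩ (openConn a b)ᶜ ∩ (openConn b c)ᶜ) -
        (prodBernoulli u).real ((openConn s a)ᶜ ∩ (openConn s b)ᶜ ∩ (openConn a b)ᶜ ∩ (openConn a c)ᶜ ∩ (openConn b c)ᶜ) -
        (prodBernoulli u).real ((openConn s a)ᶜ ∩ (openConn s b)ᶜ ∩ (openConn s c)ᶜ ∩ (openConn a b)ᶜ ∩ (openConn b c)ᶜ) +
        (prodBernoulli u).real ((openConn s a)ᶜ ∩ (openConn s b)ᶜ ∩ (openConn s c)ᶜ ∩ (openConn a b)ᶜ ∩ (openConn a c)ᶜ ∩ (openConn b c)ᶜ) -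
        (prodBernoulli u).real ((openConn s b)ᶜ ∩ (openConn s c)ᶜ ∩ (openConn a b)ᶜ ∩ (openConn a c)ᶜ ∩ (openConn b c)ᶜ) +
        (prodBernoulli u).real ((openConn s a)ᶜ ∩ (openConn s b)ᶜ ∩ (openConn s c)ᶜ ∩ (openConn a b)ᶜ ∩ (openConn a c)ᶜ ∩ (openConn b c)ᶜ) := by
  have hmono : ∀ {X Y : Set (BondConfig V)}, X ⊆ Y → (prodBernoulli u).real X ≤ (prodBernoulli u).real Y := fun h =>
    measureReal_mono h
  refine ⟨hmono ?_, hmono ?_, hmono ?_, hmono ?_, measureReal_le_one, ?_, ?_⟩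
  · rintro ω ⟨⟨⟨⟨⟨-, h2⟩, h3⟩, h4⟩, h5⟩, h6⟩; exact ⟨⟨⟨⟨h2, h3⟩, h4⟩, h5⟩, h6⟩
  · rintro ω ⟨h, -⟩; exact h
  · rintro ω ⟨⟨⟨⟨⟨h1, h2⟩, -⟩, h4⟩, h5⟩, h6⟩; exact ⟨⟨⟨⟨h1, h2⟩, h4⟩, h5⟩, h6⟩
  · rintro ω ⟨⟨⟨⟨⟨h1, h2⟩, h3⟩, h4⟩, -⟩, h6⟩; exact ⟨⟨⟨⟨h1, h2⟩, h3⟩, h4⟩, h6⟩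
  · have h1 := real_F_inter_I u s a b c
    have h2 := real_F_inter_IA u s a b c
    have h3 : (prodBernoulli u).real (openConn s a ∩ (openConn s b)ᶜ ∩ ((openConn c s)ᶜ ∩ (openConn c a)ᶜ ∩ (openConn c b)ᶜ)) ≤
        (prodBernoulli u).real (openConn s a ∩ (openConn s b)ᶜ ∩ ((openConn c s)ᶜ ∩ (openConn c a)ᶜ)) :=
      hmono (inter_subset_inter_right _ inter_subset_left)
    linarith
  · have h1 := real_F_inter_I u s a b c
    have h2 := real_F_inter_IB u s a b c
    have h3 : (prodBernoulli u).real (openConn s a ∩ (openConn s b)ᶜ ∩ ((openConn c s)ᶜ ∩ (openConn c a)ᶜ ∩ (openConn c b)ᶜ)) ≤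
        (prodBernoulli u).real (openConn s a ∩ (openConn s b)ᶜ ∩ (openConn c b)ᶜ) :=
      hmono (inter_subset_inter_right _ inter_subset_right)
    linarith

end Events

/-! ## Terminal-only weights: the terminal piece `G⁰` pair by pair -/

section Terminal
variable {κ : Type*}

/-- **Down-set probabilities of terminal-only weights multiply over supports**: if `u, u', u''` vanish on every pair with a
non-terminal end and `1 − u'' = (1 − u)(1 − u')` pairwise, then `P_{u''}(π|_T ≤ blk) = P_u(π|_T ≤ blk) · P_{u'}(π|_T ≤ blk)`
(all three are products of `1 − weight` over the terminal pairs across blocks). [this work] -/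
theorem real_partLE_terminal_mul (u u' u'' : Sym2 V → unitInterval) (T : Finset V)
    (h0 : ∀ x y : V, x ∉ T → x ≠ y → (u s(x, y) : ℝ) = 0) (h0' : ∀ x y : V, x ∉ T → x ≠ y → (u' s(x, y) : ℝ) = 0)
    (h0'' : ∀ x y : V, x ∉ T → x ≠ y → (u'' s(x, y) : ℝ) = 0)
    (hmul : ∀ e, (1 - (u'' e : ℝ)) = (1 - (u e : ℝ)) * (1 - (u' e : ℝ))) (blk : V → κ) :
    (prodBernoulli u'').real (partLE T blk) = (prodBernoulli u).real (partLE T blk) * (prodBernoulli u').real (partLE T blk) := by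
  rw [real_partLE_terminalPiece u'' T blk h0'', real_partLE_terminalPiece u T blk h0, real_partLE_terminalPiece u' T blk h0',
    ← Finset.prod_mul_distrib]
  exact Finset.prod_congr rfl fun e _ => hmul e

/-- The empty graph: under the zero weight every down-set has probability `1`. [this work] -/
theorem real_partLE_zero (T : Finset V) (blk : V → κ) :
    (prodBernoulli fun _ : Sym2 V => (0 : unitInterval)).real (partLE T blk) = 1 := by
  rw [real_partLE_terminalPiece _ T blk fun _ _ _ _ => rfl]
  simp

omit [Fintype V] in
/-- In a configuration using only the pair `e`, two distinct vertices are joined only if `e` is their pair. [folklore] -/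
theorem reachable_subset_singleton {ω : BondConfig V} {e : Sym2 V} (hω : ω ⊆ {e}) {x y : V} (hxy : x ≠ y)
    (h : (openGraph ω).Reachable x y) : s(x, y) = e := by
  obtain ⟨p⟩ := h
  induction p with
  | nil => exact (hxy rfl).elim
  | @cons p q r hadj rest ih =>
    rw [openGraph_adj] at hadj
    have hpq : s(p, q) = e := mem_singleton_iff.1 (hω hadj.1)
    by_cases hqr : q = r
    · rw [← hqr]; exact hpq
    · have hqr' := ih hqr
      -- both `s(p,q)` and `s(q,r)` equal `e`: then `{p,q} = {q,r}`, so `p = q` or `p = r` — both excluded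
      rw [← hqr'] at hpq
      rcases Sym2.eq_iff.1 hpq with ⟨h1, -⟩ | ⟨h1, -⟩
      · exact (hadj.2 h1).elim
      · exact (hxy h1).elim

/-- **A one-pair weight joins nothing but its pair**: if `u` vanishes off the pair `e`, then `P_u(x ↔ y) = 0` for all `x ≠ y` with
`s(x,y) ≠ e`. [this work] -/
theorem real_openConn_eq_zero_of_single (u : Sym2 V → unitInterval) (e : Sym2 V) (hu : ∀ e', e' ≠ e → (u e' : ℝ) = 0)
    {x y : V} (hxy : x ≠ y) (he : s(x, y) ≠ e) : (prodBernoulli u).real (openConn x y) = 0 := by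
  classical
  -- off the null event "some pair other than `e` is open", `x ↔ y` is impossible
  set Z : Finset (Sym2 V) := Finset.univ.filter fun e' => e' ≠ e with hZ
  have hN : (prodBernoulli u).real {ω : BondConfig V | ∃ e' ∈ Z, e' ∈ ω} = 0 := by
    refine le_antisymm ((Literature.Probability.LatticeModels.prodBernoulli_real_exists_mem_le_sum u Z).trans (le_of_eq ?_))
      measureReal_nonneg
    refine Finset.sum_eq_zero fun e' he' => ?_
    rw [hZ, Finset.mem_filter] at he'
    exact hu e' he'.2
  have hsub : (openConn x y : Set (BondConfig V)) ⊆ {ω : BondConfig V | ∃ e' ∈ Z, e' ∈ ω} := by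
    intro ω hω
    by_contra hno
    simp only [mem_setOf_eq, not_exists, not_and] at hno
    have hωe : ω ⊆ {e} := by
      intro e' he'
      by_contra hne
      exact hno e' (by rw [hZ, Finset.mem_filter]; exact ⟨Finset.mem_univ _, hne⟩) he'
    exact he (reachable_subset_singleton hωe hxy hω)
  exact le_antisymm ((measureReal_mono hsub).trans hN.le) measureReal_nonneg

end Terminal

end Summit.CriticalPhenomena.PercolationContinuityZ3.Theorems.SuperTerminalDownsetEvents
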